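import Summits.CriticalPhenomena.SAWScalingLimit.Theorems.SAWDefectDecoherenceBoundaryClosureRIdentificationGateHopf
import Summits.CriticalPhenomena.SAWScalingLimit.Theorems.SAWDefectDecoherenceBoundaryClosureRIdentificationUniformiser
import Summits.CriticalPhenomena.SAWScalingLimit.Theorems.SAWDefectDecoherenceBoundaryClosureRPickEngineStage2
import Literature.Probability.RandomPlanarGeometry.ChordalBoundary
import Literature.Probability.RandomPlanarGeometry.ConformalMapCaratheodoryProofs
import Literature.Analysis.Complex.SchwarzReflection

/-!
# `BoundaryClosureR`, line `pick-half-plane`, stub `stub_gateTrace` (a): regularity of the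
# conformal frame along the open flat gate

Support for the registered stub `stub_gateTrace : GateTrace` of the crux `BoundaryClosureR`
(stmt-CriticalPhenomena-14004, route `SAWDefectDecoherence`, line `pick-half-plane`).  `GateTrace`
quantifies over the conformal data `(Φ, L, L_b)` of a Dobrushin domain `D`: a conformal
equivalence `Φ : Ω → ℍₒ` of the carrier with `‖Φ‖ → ∞` at the root `D.pt 0`, a continuous
branch `L` of `log Φ'` on `Ω`, and asks for limits of `g · exp(−(5/8)(L − L_b))` at the points of
the flat gate `{im z = im (D.pt 1)} ∩ B(D.pt 1, ρ)` (where `Ω` is locally the upper half-plane).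
Its CLASSICAL half is the boundary regularity of the frame proved here:

* `exists_frameExtension` — **Carathéodory extension of the frame**: `Φ` extends to a function
  `Φ*` continuous on `closure Ω ∖ {D.pt 0}` and REAL on `∂Ω` (the tree's Carathéodory theorem
  `JordanDomain.exists_continuousOn_extension_holds` for `Φ⁻¹ ∘ cayley⁻¹ : 𝔻 → Ω`, whose
  extension is a continuous bijection of the compact closed disc onto `closure Ω`, hence has a
  continuous inverse; the root is the preimage of `1 = cayley(∞)` because `‖Φ‖ → ∞` there, and
  the Cayley transform is continuous and real on the unit circle off `1`).
* `gateTrace_frameRegular` (registered helper of `stub_gateTrace`) — **the branch `L` of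
  `log Φ'` has a finite limit within `Ω` at every gate point `y ≠ D.pt 0`**: Schwarz reflection
  of `Φ*(· + y)` across the diameter of a small disc (`Complex.differentiableOn_schwarzReflection`),
  the boundary Hopf lemma `deriv_ne_zero_of_im_pos` (the reflected map `R` has `R'(0) ≠ 0`, from
  `Im R > 0` above the axis — no injectivity needed), a local holomorphic logarithm
  `M = log(R'/R'(0)) + log R'(0)` of `R'` near `0`, and the rigidity of continuous logarithms on
  the (convex) upper half-disc (`sub_eq_sub_of_exp_eq_mul_exp`: `L(· + y) − M` is constant), so
  `L(z) → M(0) + const` as `z → y` within `Ω`.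

The exceptional point is genuine: at the root `Φ' ∼ (z − pt 0)⁻²` and `L → ∞`; if the root lies
on the gate segment (allowed by the pins when `im (pt 0) = im (pt 1)`), `L` has no finite limit
there, whence the clause `y ≠ D.pt 0`.  References: Pommerenke, *Boundary Behaviour of Conformal
Maps* (1992), Thm. 2.6; Conway, *Functions of One Complex Variable I* (1978), IX.1.1.
-/

noncomputable section

open scoped Topology ComplexConjugate
open Filter Set Metric Complex
open UpperHalfPlane (upperHalfPlaneSet)
open Literature.Probability.RandomPlanarGeometry

namespace Summit.CriticalPhenomena.SAWScalingLimit.Theorems.PickHalfPlane.Identification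

/-- **Carathéodory extension of the conformal frame.** For a Dobrushin domain `D` and a conformal
equivalence `Φ : Ω → ℍₒ` of its carrier with `‖Φ‖ → ∞` at the root `D.pt 0` (within `Ω`), there
is `Φ* : ℂ → ℂ`, continuous on `closure Ω ∖ {D.pt 0}`, equal to `Φ` on `Ω`, and real on `∂Ω`.
(Carathéodory's theorem for the Jordan domain `Ω` applied to `Φ⁻¹ ∘ cayley⁻¹`; the inverse of
the extension is continuous by compactness, maps `∂Ω` to the unit circle and only the root to `1`;
compose with `cayley⁻¹`, continuous off `1` and real on the circle.)
[cite: PommerenkeBBCM1992, Thm. 2.6] -/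
theorem exists_frameExtension (D : DobrushinDomain)
    (Φ : ConformalEquiv D.carrier upperHalfPlaneSet)
    (hΦ : Tendsto (fun z => ‖Φ z‖) (𝓝[D.carrier] (D.pt 0)) atTop) :
    ∃ Φs : ℂ → ℂ, ContinuousOn Φs (closure D.carrier \ {D.pt 0}) ∧ EqOn Φs Φ D.carrier ∧
      ∀ p ∈ frontier D.carrier, (Φs p).im = 0 := by
  obtain ⟨Ψ, hΨ⟩ := JordanDomain.exists_isDiscExtension
    JordanDomain.exists_continuousOn_extension_holds Φ.symm
  set g : ℂ → ℂ := Function.invFunOn Ψ (closedBall 0 1) with hg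
  set Φs : ℂ → ℂ := fun p => cayleyInvFun (g p) with hΦs
  have hinv : InvOn g Ψ (closedBall 0 1) (closure D.carrier) := hΨ.bijOn.invOn_invFunOn
  have hgΨ : ∀ p ∈ closure D.carrier, Ψ (g p) = p := fun p hp => hinv.2 hp
  have hcl0 : D.pt 0 ∈ closure D.carrier := frontier_subset_closure (D.pt_mem_frontier 0)
  -- on the carrier `g = cayleyFun ∘ Φ`, so `Φs = Φ`
  have hgcar : ∀ z ∈ D.carrier, g z = cayleyFun (Φ z) := by
    intro z hz
    have hw : 0 < (Φ z).im := Φ.mapsTo hz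
    have h1 : Ψ (cayleyFun (Φ z)) = z := by
      rw [← hΨ.boundaryExtension_eq hw.le, Φ.symm.boundaryExtension_eq (Φ.mapsTo hz),
        Φ.symm_apply_apply hz]
    have h2 := hΨ.bijOn.injOn.leftInvOn_invFunOn
      (mem_closedBall_zero_iff.2 (norm_cayleyFun_le_one hw.le))
    rw [h1] at h2
    exact h2
  have heq : EqOn Φs Φ D.carrier := by
    intro z hz
    have hw : 0 < (Φ z).im := Φ.mapsTo hz
    simp only [hΦs]
    rw [hgcar z hz, cayleyInvFun_cayleyFun (add_I_ne_zero hw.le)]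
  -- `g`, hence `Φs` off `g ⁻¹ {1}`, is continuous on `closure Ω`
  have hgc : ContinuousOn g (closure D.carrier) := by
    rw [hg, ← hΨ.bijOn.image_eq]
    exact IsCompact.continuousOn_invFunOn (isCompact_closedBall 0 1) hΨ.continuousOn
      hΨ.bijOn.injOn
  have hΦsc : ContinuousOn Φs {p ∈ closure D.carrier | g p ≠ 1} :=
    differentiableOn_cayleyInvFun.continuousOn.comp (hgc.mono (sep_subset _ _)) fun p hp => hp.2
  -- the root is the preimage of `1`: otherwise `Φ` would have a finite limit there
  have hg0 : g (D.pt 0) = 1 := by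
    by_contra hne
    haveI : NeBot (𝓝[D.carrier] (D.pt 0)) := mem_closure_iff_nhdsWithin_neBot.1 hcl0
    have hsub : D.carrier ⊆ {p ∈ closure D.carrier | g p ≠ 1} := fun z hz =>
      ⟨subset_closure hz, by rw [hgcar z hz]; exact cayleyFun_ne_one _⟩
    have h1 : Tendsto Φs (𝓝[D.carrier] (D.pt 0)) (𝓝 (Φs (D.pt 0))) :=
      ((hΦsc (D.pt 0) ⟨hcl0, hne⟩).mono hsub).tendsto
    have h2 : Tendsto (fun z => ‖Φ z‖) (𝓝[D.carrier] (D.pt 0)) (𝓝 ‖Φs (D.pt 0)‖) :=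
      (h1.congr' (eventually_mem_nhdsWithin.mono fun z hz => heq hz)).norm
    exact h2.not_tendsto (disjoint_nhds_atTop _) hΦ
  have hgne : ∀ p ∈ closure D.carrier \ {D.pt 0}, g p ≠ 1 := by
    rintro p ⟨hp, hp0⟩ h1
    apply hp0
    rw [mem_singleton_iff]
    calc p = Ψ (g p) := (hgΨ p hp).symm
      _ = Ψ (g (D.pt 0)) := by rw [h1, hg0]
      _ = D.pt 0 := hgΨ _ hcl0
  refine ⟨Φs, hΦsc.mono fun p hp => ⟨hp.1, hgne p hp⟩, heq, fun p hp => ?_⟩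
  exact cayleyInvFun_im_eq_zero (mem_sphere_zero_iff_norm.1 (hΨ.invFunOn_mem_sphere hp).1)

/-- Under local flatness `Ω ∩ B(y, ε) = {im > im y} ∩ B(y, ε)`, the points of the diameter
`{im = im y} ∩ B(y, ε)` lie in the closure of `Ω` (approach vertically from above). [folklore] -/
theorem mem_closure_of_flat {Ω : Set ℂ} {y z : ℂ} {ε : ℝ}
    (hflat : Ω ∩ ball y ε = {w : ℂ | y.im < w.im} ∩ ball y ε) (hz : z ∈ ball y ε)
    (hzim : z.im = y.im) : z ∈ closure Ω := by
  have hray := tendsto_ray z I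
  refine mem_closure_of_tendsto hray ?_
  filter_upwards [hray (isOpen_ball.mem_nhds hz), self_mem_nhdsWithin] with s hs hs0
  have hmem : z + (s : ℂ) * I ∈ Ω ∩ ball y ε := by
    rw [hflat]
    refine ⟨?_, hs⟩
    show y.im < (z + (s : ℂ) * I).im
    simpa [hzim] using hs0
  exact hmem.1

/-- **Regularity of the conformal frame along the open flat gate (registered helper
`gateTrace_frameRegular` of stub `stub_gateTrace`, its classical part (a)).** Let `D` be a
Dobrushin domain whose carrier `Ω` is the open upper half-plane above `D.pt 1` inside
`B(D.pt 1, ρ)`, `Φ : Ω → ℍₒ` a conformal equivalence with `‖Φ‖ → ∞` at the root `D.pt 0` (within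
`Ω`), and `L` a continuous branch of `log Φ'` on `Ω`.  Then at every gate point
`y ∈ {im = im (D.pt 1)} ∩ B(D.pt 1, ρ)` OTHER THAN THE ROOT, `L` has a finite limit within `Ω`.
(Carathéodory extension `exists_frameExtension`; Schwarz reflection of `Φ*(· + y)` in a small
disc; boundary Hopf lemma `deriv_ne_zero_of_im_pos` for the reflected map `R`; the local
logarithm `log(R'/R'(0)) + log R'(0)` of `R'` differs from `L(· + y)` by a constant on the upper
half-disc, `sub_eq_sub_of_exp_eq_mul_exp`.)  At the root itself `L → ∞`, so the clause
`y ≠ D.pt 0` cannot be dropped. [cite: PommerenkeBBCM1992, Thm. 2.6] -/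
theorem gateTrace_frameRegular : ∀ (D : DobrushinDomain) (ρ : ℝ),
    D.carrier ∩ Metric.ball (D.pt 1) ρ = {z : ℂ | (D.pt 1).im < z.im} ∩ Metric.ball (D.pt 1) ρ →
    ∀ (Φ : ConformalEquiv D.carrier UpperHalfPlane.upperHalfPlaneSet) (L : ℂ → ℂ),
      Tendsto (fun z => ‖Φ z‖) (𝓝[D.carrier] (D.pt 0)) atTop →
      ContinuousOn L D.carrier → (∀ z ∈ D.carrier, Complex.exp (L z) = deriv Φ z) →
    ∀ y : ℂ, y.im = (D.pt 1).im → y ∈ Metric.ball (D.pt 1) ρ → y ≠ D.pt 0 →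
      ∃ Ly : ℂ, Tendsto L (𝓝[D.carrier] y) (𝓝 Ly) := by
  intro D ρ hflat Φ L hΦ hL hexp y hyim hyρ hy0
  obtain ⟨Φs, hΦsc, hΦse, hΦsr⟩ := exists_frameExtension D Φ hΦ
  have hU : IsOpen D.carrier := D.isOpen
  -- Step 1: a disc around `y` inside the gate ball and away from the root
  obtain ⟨ε, hε, hεsub, hε0⟩ :
      ∃ ε : ℝ, 0 < ε ∧ ball y ε ⊆ ball (D.pt 1) ρ ∧ D.pt 0 ∉ ball y ε := by
    refine ⟨min (ρ - dist y (D.pt 1)) (dist (D.pt 0) y),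
      lt_min (by rw [sub_pos]; exact mem_ball.1 hyρ) (dist_pos.2 hy0.symm), ?_, fun h => ?_⟩
    · exact (ball_subset_ball (min_le_left _ _)).trans
        (ball_subset_ball' (sub_add_cancel ρ (dist y (D.pt 1))).le)
    · exact lt_irrefl _ (lt_min_iff.1 (mem_ball.1 h)).2
  have hflat' : D.carrier ∩ ball y ε = {z : ℂ | y.im < z.im} ∩ ball y ε :=
    Engine.flat_of_subset hflat hyim hεsub
  have hcar : ∀ z ∈ ball y ε, (z ∈ D.carrier ↔ y.im < z.im) := fun z hz => by
    have h := Set.ext_iff.1 hflat' z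
    simp only [mem_inter_iff, mem_setOf_eq] at h
    exact ⟨fun h' => (h.1 ⟨h', hz⟩).1, fun h' => (h.2 ⟨h', hz⟩).1⟩
  have hclos : ∀ z ∈ ball y ε, y.im ≤ z.im → z ∈ closure D.carrier \ {D.pt 0} := by
    intro z hz hzim
    refine ⟨?_, fun h => hε0 (mem_singleton_iff.1 h ▸ hz)⟩
    rcases hzim.lt_or_eq with hlt | heq
    · exact subset_closure ((hcar z hz).2 hlt)
    · exact mem_closure_of_flat hflat' hz heq.symm
  have hfront : ∀ z ∈ ball y ε, z.im = y.im → z ∈ frontier D.carrier := by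
    intro z hz hzim
    rw [frontier, hU.interior_eq]
    refine ⟨mem_closure_of_flat hflat' hz hzim, fun hzU => ?_⟩
    have h := (hcar z hz).1 hzU
    rw [hzim] at h
    exact lt_irrefl _ h
  -- Step 2: translate to the origin and reflect across the real axis
  have hball : ∀ w : ℂ, w ∈ ball (0 : ℂ) ε ↔ w + y ∈ ball y ε := fun w => by
    rw [mem_ball_zero_iff, mem_ball, dist_eq_norm, add_sub_cancel_right]
  have hmemU : ∀ w ∈ ball (0 : ℂ) ε, 0 < w.im → w + y ∈ D.carrier := fun w hw hwim =>
    (hcar (w + y) ((hball w).1 hw)).2 (by simpa using hwim)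
  set f₀ : ℂ → ℂ := fun w => Φs (w + y) with hf₀
  have hsymm : ∀ w ∈ ball (0 : ℂ) ε, conj w ∈ ball (0 : ℂ) ε := fun w hw => by
    rwa [mem_ball_zero_iff, norm_conj, ← mem_ball_zero_iff]
  have hc : ContinuousOn f₀ (ball (0 : ℂ) ε ∩ {w | 0 ≤ w.im}) := by
    refine hΦsc.comp (continuous_id.add continuous_const).continuousOn ?_
    rintro w ⟨hw, hwim⟩
    exact hclos (w + y) ((hball w).1 hw) (by simpa using hwim)
  have hd : DifferentiableOn ℂ f₀ (ball (0 : ℂ) ε ∩ {w | 0 < w.im}) := by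
    rintro w ⟨hw, hwim⟩
    have hwy : w + y ∈ D.carrier := hmemU w hw hwim
    have h1 : DifferentiableAt ℂ Φs (w + y) :=
      ((Φ.differentiableOn _ hwy).differentiableAt (hU.mem_nhds hwy)).congr_of_eventuallyEq
        (Filter.eventuallyEq_of_mem (hU.mem_nhds hwy) hΦse)
    exact (h1.comp w (differentiableAt_id.add_const y)).differentiableWithinAt
  have hreal : ∀ w ∈ ball (0 : ℂ) ε, w.im = 0 → conj (f₀ w) = f₀ w := by
    intro w hw hwim
    refine conj_eq_iff_im.2 ?_
    exact hΦsr (w + y) (hfront (w + y) ((hball w).1 hw) (by simp [hwim]))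
  set R : ℂ → ℂ := schwarzReflection f₀ with hRdef
  have hR : DifferentiableOn ℂ R (ball (0 : ℂ) ε) :=
    differentiableOn_schwarzReflection isOpen_ball hsymm hc hd hreal
  have hRup : ∀ w ∈ ball (0 : ℂ) ε, 0 < w.im → R w = Φ (w + y) := fun w hw hwim => by
    rw [hRdef, schwarzReflection_of_nonneg hwim.le]
    exact hΦse (hmemU w hw hwim)
  have hb0 : ball (0 : ℂ) ε ∈ 𝓝 (0 : ℂ) := isOpen_ball.mem_nhds (mem_ball_self hε)
  -- Step 3: the boundary Hopf lemma at the gate point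
  have hR0 : deriv R 0 ≠ 0 := by
    refine deriv_ne_zero_of_im_pos (by simp) (hR.analyticAt hb0) ?_ ?_
    · filter_upwards [hb0] with w hw hwim
      rw [hRdef, schwarzReflection_of_nonneg hwim.symm.le]
      exact hΦsr (w + y) (hfront (w + y) ((hball w).1 hw) (by simp [hwim]))
    · filter_upwards [hb0] with w hw hwim
      rw [hRup w hw hwim]
      exact Φ.mapsTo (hmemU w hw hwim)
  -- Step 4: a local holomorphic logarithm `M` of `R'` near `0`
  set R' : ℂ → ℂ := deriv R with hR'def
  have hR'c : ContinuousOn R' (ball (0 : ℂ) ε) :=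
    ((hR.analyticOnNhd isOpen_ball).deriv).continuousOn
  obtain ⟨δ, hδ, hδR⟩ :=
    Metric.continuousAt_iff.1 (hR'c.continuousAt hb0) ‖R' 0‖ (norm_pos_iff.2 hR0)
  set ε' : ℝ := min ε δ with hε'
  have hε'pos : 0 < ε' := lt_min hε hδ
  have hε'ε : ball (0 : ℂ) ε' ⊆ ball 0 ε := ball_subset_ball (min_le_left _ _)
  have hslit : ∀ w ∈ ball (0 : ℂ) ε', R' w / R' 0 ∈ slitPlane := by
    intro w hw
    have h1 : dist (R' w) (R' 0) < ‖R' 0‖ :=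
      hδR (lt_of_lt_of_le (mem_ball.1 hw) (min_le_right _ _))
    have h2 : R' w / R' 0 = 1 + (R' w - R' 0) / R' 0 := by
      field_simp
      ring
    rw [h2]
    refine mem_slitPlane_of_norm_lt_one ?_
    rwa [norm_div, div_lt_one (norm_pos_iff.2 hR0), ← dist_eq_norm]
  set M : ℂ → ℂ := fun w => Complex.log (R' w / R' 0) + Complex.log (R' 0) with hMdef
  have hMexp : ∀ w ∈ ball (0 : ℂ) ε', Complex.exp (M w) = R' w := by
    intro w hw
    simp only [hMdef]
    rw [Complex.exp_add, Complex.exp_log (slitPlane_ne_zero (hslit w hw)), Complex.exp_log hR0,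
      div_mul_cancel₀ _ hR0]
  have hMc : ContinuousOn M (ball (0 : ℂ) ε') := by
    refine ContinuousOn.add ?_ continuousOn_const
    exact ContinuousOn.comp (g := Complex.log)
      (fun z hz => (continuousAt_clog hz).continuousWithinAt) ((hR'c.mono hε'ε).div_const _) hslit
  -- Step 5: `L (· + y)` and `M` are two continuous logarithms of `R'` on the upper half-disc
  set N : Set ℂ := ball (0 : ℂ) ε' ∩ {w | 0 < w.im} with hNdef
  have hNpc : IsPreconnected N :=
    ((convex_ball (0 : ℂ) ε').inter (convex_halfSpace_im_gt 0)).isPreconnected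
  have hNU : ∀ w ∈ N, w + y ∈ D.carrier := fun w hw => hmemU w (hε'ε hw.1) hw.2
  have hL₁ : ContinuousOn (fun w => L (w + y)) N :=
    hL.comp (continuous_id.add continuous_const).continuousOn hNU
  have hMN : ContinuousOn M N := hMc.mono inter_subset_left
  have hderiv : ∀ w ∈ N, deriv Φ (w + y) = R' w := by
    intro w hw
    have hev : R =ᶠ[𝓝 w] fun w' => Φ (w' + y) := by
      filter_upwards [isOpen_ball.mem_nhds (hε'ε hw.1),
        (isOpen_lt continuous_const continuous_im).mem_nhds hw.2] with w' hw' hw'im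
      exact hRup w' hw' hw'im
    rw [hR'def, hev.deriv_eq, deriv_comp_add_const]
  have hexpN : ∀ w ∈ N, Complex.exp (L (w + y)) = ((1 : ℝ) : ℂ) * Complex.exp (M w) := by
    intro w hw
    rw [Complex.ofReal_one, one_mul, hMexp w hw.1, hexp _ (hNU w hw), hderiv w hw]
  set q : ℂ := ((ε' / 2 : ℝ) : ℂ) * I with hqdef
  have hqN : q ∈ N := by
    refine ⟨?_, ?_⟩
    · rw [mem_ball_zero_iff, hqdef, norm_mul, norm_real, norm_I, mul_one, Real.norm_eq_abs,
        abs_of_pos (half_pos hε'pos)]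
      exact half_lt_self hε'pos
    · show 0 < q.im
      rw [hqdef]
      simpa using hε'pos
  have key := sub_eq_sub_of_exp_eq_mul_exp hNpc (subset_closure hqN) hMN hL₁ one_pos hexpN
    (hMN.continuousWithinAt hqN) (hL₁.continuousWithinAt hqN)
  -- Step 6: the limit of `L` at `y` within the carrier
  refine ⟨M 0 - M q + L (q + y), ?_⟩
  have hM0 : Tendsto M (𝓝[N] 0) (𝓝 (M 0)) :=
    (hMc.continuousAt (isOpen_ball.mem_nhds (mem_ball_self hε'pos))).tendsto.mono_left
      nhdsWithin_le_nhds
  have hT : Tendsto (fun w => L (w + y)) (𝓝[N] 0) (𝓝 (M 0 - M q + L (q + y))) := by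
    refine ((hM0.sub_const (M q)).add_const (L (q + y))).congr' ?_
    filter_upwards [self_mem_nhdsWithin] with w hw
    have h := key w hw
    simp only at h
    linear_combination -h
  have hmap : Tendsto (fun z => z - y) (𝓝[D.carrier] y) (𝓝[N] 0) := by
    refine tendsto_nhdsWithin_iff.2 ⟨?_, ?_⟩
    · have h : Tendsto (fun z => z - y) (𝓝 y) (𝓝 (y - y)) :=
        (continuous_id.sub continuous_const).tendsto y
      rw [sub_self] at h
      exact h.mono_left nhdsWithin_le_nhds
    · have hb : ball y ε' ∈ 𝓝[D.carrier] y := mem_nhdsWithin_of_mem_nhds (ball_mem_nhds y hε'pos)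
      filter_upwards [hb, self_mem_nhdsWithin] with z hz hzU
      have hz' : z - y ∈ ball (0 : ℂ) ε' := by
        rwa [mem_ball_zero_iff, ← dist_eq_norm, ← mem_ball]
      refine ⟨hz', ?_⟩
      show 0 < (z - y).im
      rw [sub_im, sub_pos]
      exact (hcar z (ball_subset_ball (min_le_left _ _) hz)).1 hzU
  have h := hT.comp hmap
  simpa only [Function.comp_def, sub_add_cancel] using h

end Summit.CriticalPhenomena.SAWScalingLimit.Theorems.PickHalfPlane.Identification

end
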